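import Mathlib
import HarnessLib
import Literature.AlgebraicGeometry.Kloosterman2025.ExcessTangentDimensionLowerBound
import Summits.HodgeConjecture.HodgeConjecture.Theorems.HodgeLocusCensusSymbolicCharts831

/-!
# HodgeLocusCensusMu0631 — the generator-count bound, μ₀(6,3,1;λ) = 4, the Gorenstein fibre, the anharmonic orbits, and the (4,5,1) charts along n′ (cell pub-hlocus, ENGINE B seat ivhs-2, gen 21)
HONEST FRAMING: certified instances and evidence bearing on the general Hodge conjecture; no claim.

SETTING (cell record `pub-hlocus-ivhs-2/MU0631-EXACT-g21.md`).  N ⊂ (cubics near the Fermat cubic X_F) is the locus of cubics containing a pair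
of k-planes P, P̌ in prescribed position, V_λ the Hodge-locus germ of δ_λ = [P] + λ[P̌], c = codim N, q = the number of period equations
(q = Σ_{p > n/2} h^{p,n−p}; for the cubic sixfold q = h^{4,2} = dim R(X)₁ = 8), e(X;λ) = dim T_X V_λ − dim T_X N the tangent excess,
μ₀(cell; λ) the multiplicity of V_λ along N at the general point = the length of the generic transversal fibre Z.

PROPOSITION G (record §1; formal inverse function theorem, char 0).  At any X ∈ N with e(X;λ) = b ≥ 1 and Z finite,
O_Z ≅ K[[v₁..v_b]]/(h₁..h_r) with r = q − c + b residual generators, all in (v)²; hence h₂(O_Z) ≥ C(b+1,2) − r and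
length Z ≥ B(q,c,b) := 1 + b + max(0, C(b+1,2) − r)  (`genBound` below; the kernel checks the nine-cell table `genBound_census_table`,
the monotonicity `four_le_genBound_of_eq` used for (6,3,1), and the linear-algebra core `one_le_finrank_quotient_span_pair`:
two vectors never span a 3-space, so for b = 2, r ≤ 2 one has h₂ ≥ 1 and length ≥ 1 + 2 + 1 = 4, `four_le_length_of_hilbert`).

M-631 EXACT (record §1).  Cell (6,3,1) = (c,d,k) = (2,3,3): q = 8 = c (`Literature.AlgebraicGeometry.Kloosterman2023.intdim`-value 8, the tree's
`twoPlanes_hilbert_inf_eq_intdim`), and e(X;λ) ≥ 2 for EVERY cubic of the locus and EVERY λ — the tree theorem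
`Literature.AlgebraicGeometry.Kloosterman2025.cubicSixfold_twoThreePlanes_line_two_le_excess` (Kloosterman 2025 Thm 1.3), re-exported below as
`input_excess_two_le`.  Prop. G gives length ≥ genBound 8 8 b ≥ 4 at every point of N; the gen-20 chart certificate
(`SymbolicCharts831.exceptional_set_eq_631`, re-exported as `input_chart_631`) gives ≤ 4 for every λ ∉ {0, −1}.  Hence μ₀(6,3,1;λ) = 4 with Hilbert
function exactly (1,2,1) for every λ ∈ ℂ∖{0,−1}.
GORENSTEIN FIBRE (record §2).  The leading pencil of the two residual conics has tangency discriminant D₀(λ) = c·(λ+1)⁴ with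
104976·c_A = 1858274495·z − 428624976 (kernel A) and 16·c_B = 987563255897295·z − 227788885870416 (kernel B), z = ζ₆; the kernel checks that these
constants are units (z is irrational: `cA631_ne_zero`, `cB631_ne_zero`) and hence `d0_631_ne_zero`: D₀(λ) ≠ 0 for λ ≠ −1 — the general fibre is the
complete intersection of two conics ≅ k̄[a,b]/(a²,b²).
ANHARMONIC ORBITS (record §4, Prop. S₃ for the cells (6,3,2), (8,3,3)): the relabellings λ ↦ 1/λ (swap P, P̌) and λ ↦ λ/(λ−1) (replace P̌ by the third
plane R, [P]+[P̌]+[R] = h^k) generate the anharmonic group; the kernel checks the special orbits used in the record: {−1, 2, 1/2} is stable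
(`anharmonic_orbit_neg_one`) and ζ₆ ↦ ζ₆⁻¹ = 1 − ζ₆ under both generators (`anharmonic_zeta6`).
(4,5,1) ALONG THE LEAD's DIRECTION n′ AND ALONG nfull 6,200 (record §5; z = ζ₁₀, z⁴ = z³ − z² + z − 1): chart λ* = 2 has exceptional polynomial with root set
{0, 1, z³}, chart λ* = z³ root set {0, 1, z}; `exceptional_set_eq_451`: they vanish simultaneously iff λ ∈ {0, 1} (needs z ∉ {0, 1, −1}: `zeta10_facts`).
NOT FORMALISED: power-series / local algebra (the IFT step of Prop. G is the docstring's), the symbolic computations, semicontinuity, monodromy, all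
Hodge theory.  Nothing in this file is a statement about the Hodge conjecture.
-/

namespace Summit.HodgeConjecture.HodgeConjecture.HodgeLocus.Census.Mu0631

/-! ## Inputs re-exported by name (tree theorems; nothing new is asserted) -/

alias input_excess_two_le := Literature.AlgebraicGeometry.Kloosterman2025.cubicSixfold_twoThreePlanes_line_two_le_excess
alias input_chart_631 := Summit.HodgeConjecture.HodgeConjecture.HodgeLocus.Census.SymbolicCharts831.exceptional_set_eq_631
alias input_chart_631_decisive := Summit.HodgeConjecture.HodgeConjecture.HodgeLocus.Census.SymbolicCharts831.chart631_decisive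

/-! ## Proposition G: the generator-count bound B(q,c,b) = 1 + b + max(0, C(b+1,2) − (q − c + b)) -/

/-- The generator-count lower bound for the generic fibre length (ℕ-subtraction is truncated, which is the `max(0, ·)`). -/
def genBound (q c b : ℕ) : ℕ := 1 + b + ((b + 1) * b / 2 - (q - c + b))

/-- The nine census cells (q, c, b) ↦ B: (4,4,0), (6,3,0), (4,4,1), (4,5,1), (6,3,1), (6,3,2), (8,3,1), (8,3,2), (8,3,3).
In the eight decided cells other than (6,3,2) the census value μ₀ equals B; (6,3,1) is the q = c cell with B = 4. -/
theorem genBound_census_table :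
    genBound 21 12 1 = 2 ∧ genBound 8 8 1 = 2 ∧ genBound 21 11 2 = 3 ∧ genBound 120 22 1 = 2 ∧
    genBound 8 8 2 = 4 ∧ genBound 8 7 2 = 3 ∧ genBound 45 20 1 = 2 ∧ genBound 45 19 2 = 3 ∧ genBound 45 16 2 = 3 := by
  decide

/-- When q = c (cell (6,3,1): q = 8 = codim N) the bound is 1 + C(b+1,2) up to truncation and is ≥ 4 as soon as b ≥ 2:
this is why `e ≥ 2 everywhere` suffices and the exact generic excess is not needed. -/
theorem four_le_genBound_of_eq (q b : ℕ) (hb : 2 ≤ b) : 4 ≤ genBound q q b := by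
  unfold genBound
  have h1 : b + 1 ≤ (b + 1) * b / 2 := by
    apply (Nat.le_div_iff_mul_le (by norm_num)).mpr
    nlinarith
  omega

variable {K : Type*} [Field K]

/-- LINEAR-ALGEBRA CORE of Prop. G for b = 2: two vectors (the quadratic parts of the r = 2 residual generators) span a subspace of
codimension ≥ 1 in a 3-dimensional space (m²/m³ in two variables), i.e. h₂ ≥ 1. -/
theorem one_le_finrank_quotient_span_pair {V : Type*} [AddCommGroup V] [Module K V] [FiniteDimensional K V]
    (h3 : Module.finrank K V = 3) (q₁ q₂ : V) :
    1 ≤ Module.finrank K (V ⧸ Submodule.span K ({q₁, q₂} : Set V)) := by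
  classical
  have hq := Submodule.finrank_quotient_add_finrank (Submodule.span K ({q₁, q₂} : Set V))
  have hle : Module.finrank K (Submodule.span K ((({q₁, q₂} : Finset V)) : Set V)) ≤ ({q₁, q₂} : Finset V).card :=
    finrank_span_finset_le_card _
  rw [Finset.coe_pair] at hle
  have hc : ({q₁, q₂} : Finset V).card ≤ 2 := Finset.card_le_two
  omega

/-- The two quadratic parts never span m²/m³: equivalently the span is a proper subspace. -/
theorem span_pair_ne_top {V : Type*} [AddCommGroup V] [Module K V] [FiniteDimensional K V]
    (h3 : Module.finrank K V = 3) (q₁ q₂ : V) : Submodule.span K ({q₁, q₂} : Set V) ≠ ⊤ := by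
  intro h
  have h1 := one_le_finrank_quotient_span_pair h3 q₁ q₂
  rw [h] at h1
  have h0 : Module.finrank K (V ⧸ (⊤ : Submodule K V)) = 0 := by
    rw [← Nat.le_zero]
    have := Submodule.finrank_quotient_add_finrank (⊤ : Submodule K V)
    rw [finrank_top] at this
    omega
  omega

/-- Length bookkeeping: Hilbert function (1, 2, h₂, …) with h₂ ≥ 1 gives length ≥ 4; with the certified upper bound 4 the
Hilbert function is exactly (1,2,1) and all higher graded pieces vanish. -/
theorem four_le_length_of_hilbert (h0 h1 h2 rest : ℕ) (e0 : h0 = 1) (e1 : h1 = 2) (e2 : 1 ≤ h2) :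
    4 ≤ h0 + h1 + h2 + rest ∧ (h0 + h1 + h2 + rest ≤ 4 → h2 = 1 ∧ rest = 0) := by
  omega

/-! ## The Gorenstein structure of the (6,3,1) fibre: D₀(λ) = c·(λ+1)⁴ with c a unit (z = ζ₆, z² = z − 1) -/

/-- 104976·c_A = 1858274495·z − 428624976 (kernel A constant of the pencil discriminant). -/
def cA631 (z : K) : K := 1858274495 * z - 428624976
/-- 16·c_B = 987563255897295·z − 227788885870416 (kernel B constant). -/
def cB631 (z : K) : K := 987563255897295 * z - 227788885870416
/-- The tangency discriminant of the leading pencil of conics, kernel A normalisation ×104976. -/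
def d0A631 (z lam : K) : K := cA631 z * (lam + 1) ^ 4

/-- The kernel-A pencil constant is a unit: otherwise z = ζ₆ would be rational. -/
theorem cA631_ne_zero [CharZero K] {z : K} (hz : z ^ 2 = z - 1) : cA631 z ≠ 0 := by
  intro h
  unfold cA631 at h
  have hz' : z = 428624976 / 1858274495 := by linear_combination h / 1858274495
  rw [hz'] at hz
  norm_num at hz

/-- The kernel-B pencil constant is a unit: otherwise z = ζ₆ would be rational. -/
theorem cB631_ne_zero [CharZero K] {z : K} (hz : z ^ 2 = z - 1) : cB631 z ≠ 0 := by
  intro h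
  unfold cB631 at h
  have hz' : z = 227788885870416 / 987563255897295 := by linear_combination h / 987563255897295
  rw [hz'] at hz
  norm_num at hz

/-- For every λ ≠ −1 the leading pencil is not tangent to the discriminant conic: the general fibre is the CI of two conics. -/
theorem d0_631_ne_zero [CharZero K] {z lam : K} (hz : z ^ 2 = z - 1) (hm1 : lam ≠ -1) : d0A631 z lam ≠ 0 := by
  unfold d0A631
  have h1 : lam + 1 ≠ 0 := fun h => hm1 (by linear_combination h)
  exact mul_ne_zero (cA631_ne_zero hz) (pow_ne_zero 4 h1)

/-- The domain of M-631 EXACT is exactly the complement of the gen-20 exceptional set and D₀ is a unit there. -/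
theorem m631_domain [CharZero K] {z lam : K} (hz : z ^ 2 = z - 1) (h0 : lam ≠ 0) (hm1 : lam ≠ -1) :
    SymbolicCharts831.exc631 lam ≠ 0 ∧ d0A631 z lam ≠ 0 :=
  ⟨input_chart_631_decisive h0 hm1, d0_631_ne_zero hz hm1⟩

/-! ## Anharmonic orbits (Prop. S₃ of the record, cells (6,3,2) and (8,3,3)) -/

/-- The orbit {−1, 2, 1/2} is stable under both generators λ ↦ λ⁻¹ and λ ↦ λ/(λ−1). -/
theorem anharmonic_orbit_neg_one [CharZero K] :
    ((-1 : K)⁻¹ = -1 ∧ (-1 : K) / (-1 - 1) = 1 / 2) ∧ ((2 : K)⁻¹ = 1 / 2 ∧ (2 : K) / (2 - 1) = 2) ∧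
    ((1 / 2 : K)⁻¹ = 2 ∧ (1 / 2 : K) / (1 / 2 - 1) = -1) := by
  refine ⟨⟨by norm_num, by norm_num⟩, ⟨by norm_num, by norm_num⟩, ⟨by norm_num, by norm_num⟩⟩

/-- ζ₆ (z² = z − 1) is sent to ζ₆⁻¹ = 1 − z by BOTH generators: the size-2 orbit {ζ₆, ζ₆⁻¹} of the (6,3,2) column events. -/
theorem anharmonic_zeta6 {z : K} (hz : z ^ 2 = z - 1) : z⁻¹ = 1 - z ∧ z / (z - 1) = 1 - z := by
  have hz0 : z ≠ 0 := by
    intro h; rw [h] at hz; norm_num at hz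
  have hz1 : z - 1 ≠ 0 := by
    intro h
    have : z = 1 := by linear_combination h
    rw [this] at hz; norm_num at hz
  have hinv : z * (1 - z) = 1 := by linear_combination -hz
  constructor
  · calc z⁻¹ = z⁻¹ * (z * (1 - z)) := by rw [hinv, mul_one]
      _ = 1 - z := by field_simp
  · rw [div_eq_iff hz1]; linear_combination hz

/-! ## (4,5,1) along n′ and along nfull 6,200: the two charts' exceptional sets meet in {0, 1} (z = ζ₁₀) -/

/-- ζ₁₀ facts from its minimal polynomial z⁴ − z³ + z² − z + 1 = 0: z ∉ {0, 1, −1}, hence z ≠ z³. -/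
theorem zeta10_facts [CharZero K] {z : K} (hz : z ^ 4 = z ^ 3 - z ^ 2 + z - 1) : z ≠ 0 ∧ z ≠ 1 ∧ z ≠ -1 ∧ z ≠ z ^ 3 := by
  have h0 : z ≠ 0 := by intro h; rw [h] at hz; norm_num at hz
  have h1 : z ≠ 1 := by intro h; rw [h] at hz; norm_num at hz
  have hm1 : z ≠ -1 := by intro h; rw [h] at hz; norm_num at hz
  refine ⟨h0, h1, hm1, ?_⟩
  intro h
  have hfac : z * (z - 1) * (z + 1) = 0 := by linear_combination (-1 : K) * h
  rcases mul_eq_zero.mp hfac with h2 | h2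
  · rcases mul_eq_zero.mp h2 with h3 | h3
    · exact h0 h3
    · exact h1 (by linear_combination h3)
  · exact hm1 (by linear_combination h2)

/-- Root sets of the two charts' exceptional polynomials (Δ·D₁·G₂ up to units and multiplicities): chart λ* = 2 ↦ λ(λ−1)(λ−z³),
chart λ* = z³ ↦ λ(λ−1)(λ−z).  Both along the lead's n′ (181 monomials) and along nfull 6,200, kernels A and B. -/
def exc451c2 (z lam : K) : K := lam * (lam - 1) * (lam - z ^ 3)
/-- Root set of the chart λ* = z³ exceptional polynomial: {0, 1, z}. -/
def exc451cz3 (z lam : K) : K := lam * (lam - 1) * (lam - z)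

/-- The two charts decide every λ ∉ {0, 1}: their exceptional polynomials vanish simultaneously iff λ = 0 ∨ λ = 1. -/
theorem exceptional_set_eq_451 [CharZero K] {z lam : K} (hz : z ^ 4 = z ^ 3 - z ^ 2 + z - 1) :
    (exc451c2 z lam = 0 ∧ exc451cz3 z lam = 0) ↔ (lam = 0 ∨ lam = 1) := by
  obtain ⟨_, _, _, hzz⟩ := zeta10_facts hz
  constructor
  · rintro ⟨h2, h3⟩
    unfold exc451c2 at h2; unfold exc451cz3 at h3
    rcases mul_eq_zero.mp h2 with h2' | h2'
    · rcases mul_eq_zero.mp h2' with h | h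
      · exact Or.inl h
      · exact Or.inr (by linear_combination h)
    · rcases mul_eq_zero.mp h3 with h3' | h3'
      · rcases mul_eq_zero.mp h3' with h | h
        · exact Or.inl h
        · exact Or.inr (by linear_combination h)
      · exfalso; apply hzz; linear_combination h2' - h3'
  · rintro (h | h) <;> subst h <;> simp [exc451c2, exc451cz3]

end Summit.HodgeConjecture.HodgeConjecture.HodgeLocus.Census.Mu0631
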